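import Summits.HodgeConjecture.CorCM.HypDel.M1primeOfFUPart1   -- E-FU part 1
import Summits.HodgeConjecture.CorCM.HypDel.M1primeOfFUPart2   -- E-FU part 2
import Literature.AlgebraicGeometry.ModuliOfAbelianVarieties.SiegelFineModuliSchemeExists   -- ★ (F) #63 (B-typ04) — the rung-0 named fact [Lan2013PELCompactifications, Thm. 1.4.1.11 + Cor. 7.2.3.9]
import Literature.AlgebraicGeometry.ModuliOfAbelianVarieties.SiegelModuliComplexUniformisation   -- ★ (U) #64 (B-typ02) — the named fact [MumfordFogartyKirwan1994, App. 7A; Deligne1971TravauxShimura, 4.12–4.21]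

/-!
# M1′ from (F) and (U) — E-FU PART 6 of 7 (+ HEAD `M1primeOfFU`): 
§P — the kernel-checked composition `siegelModuliOnPoints_of` over (F); `isAdmissibleAt_iff_markedBy` and § 1 — W0 CLOSER `stubW0_of_transport` over (U) (B-p11 g10); § 3a — the universal family (B-p05 g10)

Cell hodgecm-mathlib, rung 0 of the Mumford line under `HDel` (item `stmt-HodgeConjecture-24835`).  The E-FU text proves
`deligne1971_siegelModuliOnPoints` (M1′ = [Deligne 1971, 4.16–4.21 on points]) as a THEOREM of the two finer printed facts
(F) `lan2013_siegelFineModuliScheme` [Lan 2013, Thm. 1.4.1.11 + Cor. 7.2.3.9] and (U) `siegelModuli_complexUniformisation`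
[MFK94 App. 7A; Deligne 1971, 4.12–4.21; Milne 2005 Thm. 6.11]; it is split into a chain of part files only because of the
400-line cap on proof-bearing `Summits/` files (B-plan1 R22, director s96).  The composition and `theorem M1prime_of_F_U` live in
the HEAD file `Summits/HodgeConjecture/CorCM/HypDel/M1primeOfFU.lean`; provenance of every § is kept in its banner below and in
HOME `B-plan/lines/m1prime/M1primeOfFU.skeleton.md`.  This part imports (F)/(U).
HC_CM is proved only modulo the 7 printed citations until rung 0 closes.
-/

universe u   -- was declared inside the dropped D1 paste
open CategoryTheory CategoryTheory.Limits AlgebraicGeometry MonoidalCategory   -- was a TOP-LEVEL `open` of the dropped D1 paste (and of (M)); the pasted (F)/(U)/partC/§§ rely on it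

/-! ## §P (B-plan2): `isAdmissibleAt_iff_markedBy`, `towerFunctor`, THE COMPOSITION `siegelModuliOnPoints_of` — relocated whole from § 0 -/

noncomputable section

namespace Summit.HodgeConjecture.CorCM.HypDel.M1primeOfFU

open CategoryTheory CategoryTheory.Limits AlgebraicGeometry
open Literature.AlgebraicGeometry
open Literature.AlgebraicGeometry.Motives (SchemeOver ComplexPoints AlgPoints specOver AbelianVariety CartierDivisor)
open Literature.AlgebraicGeometry.AbelianSchemes (PolarizedAbelianSchemeWithLevel)
open Literature.AlgebraicGeometry.HodgeTheory (IsQuasiProjectiveOver)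
open Literature.NumberTheory.Automorphic (siegelUpperHalfSpace)
open Literature.AlgebraicGeometry.ModuliOfAbelianVarieties
open Literature.AlgebraicGeometry.ModuliOfAbelianVarieties.SiegelModuli (jOfSiegel)

/-- (U)'s admissibility predicate IS `MarkedBy` at `(J(Z), r)` — definitionally (same binder order, same clauses).
JUNCTION (rewording of the printed predicate; locator = that statement) [cite: Milne2005ShimuraVarieties, §6 Thm. 6.11 p. 74] -/
theorem isAdmissibleAt_iff_markedBy {g N : ℕ} {δ : Fin g → ℕ} (hδ : IsPolarizationType δ) (r : gspFinAdelic δ)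
    (Z : Matrix (Fin g) (Fin g) ℂ) (hZ : Z ∈ siegelUpperHalfSpace g)
    (P' : PolarizedAbelianSchemeWithLevel g N δ (specOver ℚ ℂ).left) :
    IsAdmissibleAt hδ r Z hZ P' ↔
      MarkedBy ⟨jOfSiegel δ Z, SiegelComplexRecordSystem.jOfSiegel_mem_C0pm hδ.1 hZ⟩ r P' :=
  Iff.rfl

/-- Plumbing (non-Prop def, head-internal): the `ℚ`-tower functor out of the level poset assembled from per-level
schemes and transition maps satisfying the functor laws. [folklore] -/
def towerFunctor {g' : ℕ} {δ' : Fin g' → ℕ} (M : SiegelLevel δ' → SchemeOver ℚ)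
    (tr : ∀ ⦃K K' : SiegelLevel δ'⦄, (K ⟶ K') → (M K ⟶ M K'))
    (h_id : ∀ K : SiegelLevel δ', tr (𝟙 K) = 𝟙 (M K))
    (h_comp : ∀ ⦃K K' K'' : SiegelLevel δ'⦄ (f : K ⟶ K') (f' : K' ⟶ K''), tr (f ≫ f') = tr f ≫ tr f') :
    SiegelLevel δ' ⥤ SchemeOver ℚ where
  obj := M
  map f := tr f
  map_id := h_id
  map_comp f f' := h_comp f f'

/-- **THE COMPOSITION (kernel-checked, no `sorry` of its own): (F) → W0 → W1a → W1b → W3 → W4 → M1′.**  The head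
CHOOSES the fine moduli schemes `𝓜 K` from (F) (with their (F-c′) properties), takes the tower from W1b and the level data
from W1a at that family, DERIVES ★ `map_pts` (W0 gives a marked triple at `[J, a]`, the dictionary identifies both sides,
`tr_marked` moves it, `baseChangeEquiv` is natural — ★ R60-25 `SiegelRationalModel.baseChangeEquiv_symm_map`) and the `ℂ`-side (F-c′) (base change), and sets under fork (α)
`Sg := ⟨Nm ⋙ Motives.baseChange ℚ ℂ, …⟩`, `R := ⟨Nm, qp, Iso.refl _⟩` (W2 = `Iso.refl`, literally), so that `R.ptQ K` is
`(AlgPoints.baseChangeEquiv _ _).symm` and the dictionary turns ★ `IsModuli` / ★ `HasIntegralHecke` into W3 / W4 at marked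
triples supplied by W0. JUNCTION (problem-side composition, not a printed claim; locator = the printed statement it assembles)
[cite: Deligne1971TravauxShimura, §4 4.16–4.21] [cite: MumfordFogartyKirwan1994, App. 7A] -/
theorem siegelModuliOnPoints_of (hF : lan2013_siegelFineModuliScheme) (hW0 : (∀ (g N : ℕ) (δ : Fin g → ℕ), StubW0 g N δ)) (hW1a : (∀ (g : ℕ) (δ : Fin g → ℕ), StubW1a g δ)) (hW1b : (∀ (g : ℕ) (δ : Fin g → ℕ), StubW1b g δ)) (hW3 : (∀ (g N : ℕ) (δ : Fin g → ℕ), StubW3 g N δ))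
    (hW4 : (∀ (g N : ℕ) (δ : Fin g → ℕ), StubW4 g N δ)) : deligne1971_siegelModuliOnPoints := by
  intro g δ hg hδ
  haveI : IsLocallyNoetherian (specOver ℚ ℂ).left :=
    inferInstanceAs (IsLocallyNoetherian (Spec (CommRingCat.of ℂ)))
  -- (F): CHOOSE a fine moduli scheme at every Siegel level, with its (F-c′) properties
  obtain ⟨𝓜, h𝓜⟩ : ∃ 𝓜 : ∀ K : SiegelLevel δ, SiegelFineModuliScheme g K.N δ,
      ∀ K : SiegelLevel δ, Smooth (𝓜 K).M.hom ∧ IsQuasiProjectiveOver (𝓜 K).M ∧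
        IsQuasiProjectiveOver (Over.mk ((𝓜 K).univ.A.X.hom ≫ (𝓜 K).M.hom)) :=
    ⟨fun K => (hF g K.N δ hg hδ K.three_le_N).choose, fun K => (hF g K.N δ hg hδ K.three_le_N).choose_spec⟩
  -- W1b: the tower at that family; W1a: the level data at each `𝓜 K`
  obtain ⟨tr, tr_id, tr_comp, tr_marked⟩ := hW1b g δ hg hδ 𝓜
  choose pts Q rep datum incl finQ hcolim incl_unif dict using fun K : SiegelLevel δ => hW1a g δ hg hδ K (𝓜 K)
  -- (F-c′) on the `ℂ`-side: base change of the `ℚ`-side clauses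
  have smC : ∀ K : SiegelLevel δ, AlgebraicGeometry.Smooth ((Motives.baseChange ℚ ℂ).obj (𝓜 K).M).hom := fun K => by
    haveI := (h𝓜 K).1
    change AlgebraicGeometry.Smooth (pullback.snd (𝓜 K).M.hom _)
    infer_instance
  have qpC : ∀ K : SiegelLevel δ, IsQuasiProjectiveOver ((Motives.baseChange ℚ ℂ).obj (𝓜 K).M) := fun K =>
    IsQuasiProjectiveOver.baseChangeHom (algebraMap ℚ ℂ) (h𝓜 K).2.1
  -- ★ `map_pts`, DERIVED: W0 ⊕ dictionary at `K` ⊕ `tr_marked` ⊕ dictionary at `K′` ⊕ naturality of `baseChangeEquiv`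
  have map_pts : ∀ (K K' : SiegelLevel δ) (f : K ⟶ K') (J : C0pm δ) (a : gspFinAdelic δ),
      pts K' (AlgPoints.map ((Motives.baseChange ℚ ℂ).map (tr f)) ((pts K).symm (SiegelShimuraSet.mk δ K.1 J a))) =
        SiegelShimuraSet.mk δ K'.1 J a := by
    intro K K' f J a
    obtain ⟨P', hP'⟩ := hW0 g K.N δ hg hδ K.three_le_N (𝓜 K) J a
    obtain ⟨P'', hP'', htr⟩ := tr_marked f J a P' hP'
    -- naturality of `e⁻¹ : (X ⊗ ℂ)(ℂ) ≃ X(ℂ)` (★ R60-25), read through the dictionary at `K` and at `K′`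
    have h1 := SiegelRationalModel.baseChangeEquiv_symm_map (tr f) ((pts K).symm (SiegelShimuraSet.mk δ K.1 J a))
    have h2 : AlgPoints.map ((Motives.baseChange ℚ ℂ).map (tr f)) ((pts K).symm (SiegelShimuraSet.mk δ K.1 J a)) =
        (pts K').symm (SiegelShimuraSet.mk δ K'.1 J a) := by
      apply (AlgPoints.baseChangeEquiv (algebraMap ℚ ℂ) (𝓜 K').M).symm.injective
      refine h1.trans ?_
      rw [dict K J a P' hP', dict K' J a P'' hP'']
      exact htr
    rw [h2, Equiv.apply_symm_apply]
  -- the ℚ-tower, the complex record system under fork (α), the rational model with `e := Iso.refl`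
  let Nm : SiegelLevel δ ⥤ SchemeOver ℚ := towerFunctor (fun K => (𝓜 K).M) tr tr_id tr_comp
  let Sg : SiegelComplexRecordSystem g δ :=
    { Mc := Nm ⋙ Motives.baseChange ℚ ℂ
      smooth := smC
      quasiProjective := qpC
      pts := pts
      map_pts := map_pts
      Q := Q
      finite_Q := finQ
      rep := rep
      datum := datum
      incl := incl
      isColimit := fun K => (hcolim K).some
      incl_unif := incl_unif }
  let R : SiegelRationalModel g δ Sg := ⟨Nm, fun K => (h𝓜 K).2.1, Iso.refl _⟩
  -- `ptQ` under `Iso.refl`, and the dictionary in `ptQ` currency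
  have hptQ : ∀ (K : SiegelLevel δ) (P : ComplexPoints (Sg.Mc.obj K)),
      R.ptQ K P = (AlgPoints.baseChangeEquiv (algebraMap ℚ ℂ) (𝓜 K).M).symm P := fun K P =>
    -- `R.e.inv.app K` is `𝟙 _` definitionally (`Iso.refl`, `NatTrans.id`), and `AlgPoints.map (𝟙 _) P` is `P ≫ 𝟙 _`
    congrArg (AlgPoints.baseChangeEquiv (algebraMap ℚ ℂ) (𝓜 K).M).symm (Category.comp_id P)
  have hdict : ∀ (K : SiegelLevel δ) (J : C0pm δ) (a : gspFinAdelic δ)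
      (P' : PolarizedAbelianSchemeWithLevel g K.N δ (specOver ℚ ℂ).left), MarkedBy J a P' →
        R.ptQ K ((Sg.pts K).symm (SiegelShimuraSet.mk δ K.1 J a)) = (𝓜 K).classifyingMap (specOver ℚ ℂ) P' := by
    intro K J a P' hP'
    rw [hptQ]
    -- `Sg.pts K` is `pts K` definitionally; the dictionary is stated in exactly this currency
    exact dict K J a P' hP'
  refine ⟨Sg, R, ?_, ?_⟩
  · -- `R.IsModuli` from W3 at the carrier `𝓜 K`, via the dictionary at marked triples supplied by W0
    intro K σ J J' a a' A A' m m' f hf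
    obtain ⟨k, hk, hkf⟩ := hf
    obtain ⟨P', hP'⟩ := hW0 g K.N δ hg hδ K.three_le_N (𝓜 K) J a
    obtain ⟨P'', hP''⟩ := hW0 g K.N δ hg hδ K.three_le_N (𝓜 K) J' a'
    rw [hdict K J a P' hP', hdict K J' a' P'' hP'']
    have hk' : k ∈ principalLevelSubgroup δ K.N := by rw [← K.val_eq]; exact hk
    exact hW3 g K.N δ hg hδ K.three_le_N (𝓜 K) σ J J' a a' A A' m m' f ⟨k, hk', hkf⟩ P' P'' hP' hP''
  · -- `R.HasIntegralHecke` from W4 at the carrier `𝓜 K`, via the dictionary at marked triples supplied by W0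
    intro K γ hγ
    -- v0.4: the commutativity binders of `StubW4` ([MFK94 Cor. 6.5]) discharged by ★ P33 from (F-c′) / over `Spec ℂ`
    haveI : Smooth (𝓜 K).M.hom := (h𝓜 K).1
    haveI : IsSeparated (𝓜 K).M.hom := (h𝓜 K).2.1.isVarietyPair_ofScheme.isSeparated
    haveI : IsCommMonObj (𝓜 K).univ.A.X :=
      Literature.AlgebraicGeometry.AbelianSchemes.AbelianSchemeOver.isCommMonObj_of_smooth (𝓜 K).univ.A (𝓜 K).M.hom
    obtain ⟨Tq, hTq⟩ := hW4 g K.N δ hg hδ K.three_le_N (𝓜 K) γ hγ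
    refine ⟨Tq, fun J a => ?_⟩
    obtain ⟨P', hP'⟩ := hW0 g K.N δ hg hδ K.three_le_N (𝓜 K) J a
    haveI : IsCommMonObj P'.A.X :=
      Literature.AlgebraicGeometry.AbelianSchemes.AbelianSchemeOver.isCommMonObj_of_field P'.A
    obtain ⟨P'', hP'', hcomp⟩ := hTq J a P' hP'
    rw [hdict K J a P' hP', hdict K J (a * γ) P'' hP'']
    exact hcomp

end Summit.HodgeConjecture.CorCM.HypDel.M1primeOfFU

end

/-! ## § 1 — W0 CLOSER `stubW0_of_transport` (B-p11 g10) — relocated whole from § 1 -/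

namespace Summit.HodgeConjecture.CorCM.HypDel.M1primeOfFU

open CategoryTheory AlgebraicGeometry
open Literature.AlgebraicGeometry
open Literature.AlgebraicGeometry.Motives (specOver)
open Literature.AlgebraicGeometry.AbelianSchemes (PolarizedAbelianSchemeWithLevel)
open Literature.NumberTheory.Automorphic (siegelUpperHalfSpace)
open Literature.AlgebraicGeometry.ModuliOfAbelianVarieties
open Literature.AlgebraicGeometry.ModuliOfAbelianVarieties.SiegelModuli (jOfSiegel)

/-- **W0 FROM (U) modulo the two transports**: for every `0 < g`, polarisation type `δ`, `3 ≤ N`, every fine moduli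
scheme `𝓜` of that level and every `(J, a)`, a polarised abelian scheme with level structure over `Spec ℂ` MARKED BY
`(J, a)` exists.  Route: write `[J, aK_δ(N)] = [J(Z), r_c K_δ(N)]` (★ `SiegelShimuraSet.exists_eq_mk_jOfSiegel` over the
principal representatives of ★ `exists_principalRep`), i.e. `γJ(Z)γ⁻¹ = J` and `a = γ · r_c · k⁻¹` with `γ ∈ GSp_δ(ℚ)`,
`k ∈ K_δ(N)` (★ `SiegelShimuraSet.mk_eq_mk_iff` + `QuotientGroup.eq`); (U3∃) marks a pull-back of `𝓜.univ` by
`(J(Z), r_c)` (`isAdmissibleAt_iff_markedBy`); transport by (T1) along `γ` and by (T2) along `k⁻¹`.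
[cite: Milne2005ShimuraVarieties, §6 Thm. 6.11 p. 74, §5 Lemma 5.13 p. 57] [cite: MumfordFogartyKirwan1994, App. 7A p. 235] -/
theorem stubW0_of_transport (hU : siegelModuli_complexUniformisation) (T1 : ∀ g N δ, MarkedByMulLeft g N δ)
    (T2 : ∀ g N δ, MarkedByTranslateRight g N δ) : (∀ (g N : ℕ) (δ : Fin g → ℕ), StubW0 g N δ) := by
  intro g N δ hg hδ hN 𝓜 J a
  have hN0 : N ≠ 0 := by omega
  -- principal representatives `u c`, `rep c` of the `(ℤ/N)ˣ` pieces (★ `exists_principalRep`)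
  choose u rep hu hua hrep hmult hmat using fun c : (ZMod N)ˣ => exists_principalRep δ hN0 c
  -- `[J, a] = [J(Z), rep c]` for some piece `c` and `Z ∈ 𝔥_g`
  obtain ⟨c, Z, hx⟩ := SiegelShimuraSet.exists_eq_mk_jOfSiegel hδ hN0 hu hua hmult
    (SiegelShimuraSet.mk δ (principalLevelSubgroup δ N) J a)
  -- unpack the class equation: `γ J(Z) γ⁻¹ = J` and `a⁻¹ γ (rep c) ∈ K_δ(N)`
  obtain ⟨γ, hγJ, hγa⟩ := (SiegelShimuraSet.mk_eq_mk_iff δ (principalLevelSubgroup δ N) J _ a (rep c)).1 hx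
  have hk : a⁻¹ * (gspRationalToFinAdelic δ γ * rep c) ∈ principalLevelSubgroup δ N := by
    rw [← QuotientGroup.eq]
    rw [← hγa]
    rfl
  -- (U3∃) at `(c, Z)`: a triple marked by `(J(Z), rep c)`
  obtain ⟨S, ι, unif, -, -, -, hU3⟩ := hU g N δ hg hδ hN 𝓜
  obtain ⟨⟨P', -, -, -, hadm⟩, -⟩ := hU3 c (u c) (rep c) (hu c) (hua c) (hrep c) (hmult c) (hmat c) Z.1 Z.2
  have hmark : MarkedBy ⟨jOfSiegel δ (Z : Matrix (Fin g) (Fin g) ℂ), SiegelComplexRecordSystem.jOfSiegel_mem_C0pm hδ.1 Z.2⟩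
      (rep c) P' :=
    (isAdmissibleAt_iff_markedBy hδ (rep c) Z.1 Z.2 P').1 hadm
  -- transport: left by `γ`, then right by `k⁻¹ = (a⁻¹ γ rep c)⁻¹ ∈ K_δ(N)`
  have h1 := T1 g N δ γ _ (rep c) P' hmark
  rw [hγJ] at h1
  have h2 := T2 g N δ _ (Subgroup.inv_mem _ hk) J _ P' h1
  refine ⟨P', ?_⟩
  convert h2 using 2
  rw [_root_.mul_inv_rev, inv_inv, ← mul_assoc, mul_inv_cancel, one_mul]

end Summit.HodgeConjecture.CorCM.HypDel.M1primeOfFU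

/-! ═══════════════════════════════════════════════════════════════════════════════════════════════════════════════════
# § 3 — W1a CLOSER modulo (T2) + (T1) `MarkedBy.mulLeft` + (T) `MarkedBy.transport` (B-p05 g10, bytes
`B-provers/B-p05/W1-over-skeletonV03.bypaste.B-p05g10.lean` sha16 517cd927fb6219ae ll. 2488–3484 VERBATIM; his prefix = skeleton
v0.3 ll. 1–2473 ≡ this file's skeleton part modulo the v0.4 `StubW4` binders, which § 3 does not touch). Heads: `MarkedBy.mulLeft`
(closer-§ provenance and fold history: HOME `B-plan/lines/m1prime/M1primeOfFU.skeleton.md` + the by-import twin editions.) -/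

/- ═════ B-p05 (g10, W1 pen) — W1b PART 1: THE FIBRE OF THE RESTRICTED UNIVERSAL FAMILY AT `unif_c Z` (HOME-only by paste
   over B-p01's (U) v0.5 (b) cert 6ab06e46 = text of record; D1–D4 carriers by paste, ★ T1′ by import).
   §A generic (carrier-free; will file under `Motives/` as a small leaf): the fibre of a base-changed family over an
       `L`-point `t` is ANY pullback of `f₀` along the `k`-side reading of `t`;
(closer-§ provenance and fold history: HOME `B-plan/lines/m1prime/M1primeOfFU.skeleton.md` + the by-import twin editions.) -/

/- B-plan2 (wlayer v9): §A's three PUBLIC declarations (`isPullback_fiberOver_baseChangeHom_map_point`,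
   `fiberOverBaseChangeIsoOfIsPullback`, `fiberOverBaseChangeIsoOfIsPullback_hom_left_comp`; wlayer v8 ll. 4089–4130) are ★ p682875
   `Motives/FiberBaseChangePoint` and now come from the import; ONLY B-p05's file-private pasting lemma below is kept (it is
   `private` in the ★ file too, hence invisible from here, and § 3 §B `isSmoothProjectiveFamily_univFamilyℂ` calls it by name). -/
namespace Literature.AlgebraicGeometry.Motives

section FibreOfBaseChangeOverPoint

variable {k L : Type u} [Field k] [Field L] (σ : k →+* L) {𝒳₀ S₀ : SchemeOver k} (f₀ : 𝒳₀ ⟶ S₀)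
  (t : AlgPoints ((baseChangeHom σ).obj S₀) L)

/-- `𝒳₀ ⊗_σ L = 𝒳₀ ×_{S₀} (S₀ ⊗_σ L)` (pasting; = ★ `Motives.isPullback_baseChangeHom_map_left`, re-proved to keep the
imports of this section at the level of `Motives/BaseChange`). [folklore] -/
private theorem isPullback_baseChangeHom_map'' :
    IsPullback (baseChangeHomFst σ 𝒳₀) ((baseChangeHom σ).map f₀).left f₀.left (baseChangeHomFst σ S₀) := by
  have hsnd : ((baseChangeHom σ).map f₀).left ≫ ((baseChangeHom σ).obj S₀).hom =
      ((baseChangeHom σ).obj 𝒳₀).hom := Over.w _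
  have outer : IsPullback (baseChangeHomFst σ 𝒳₀)
      (((baseChangeHom σ).map f₀).left ≫ ((baseChangeHom σ).obj S₀).hom)
      (f₀.left ≫ S₀.hom) (Spec.map (CommRingCat.ofHom σ)) := by
    rw [hsnd, Over.w f₀]
    exact IsPullback.of_hasPullback _ _
  exact outer.of_bot (baseChangeHom_map_left_comp_fst σ f₀).symm (IsPullback.of_hasPullback _ _)

end FibreOfBaseChangeOverPoint

end Literature.AlgebraicGeometry.Motives

namespace Literature.AlgebraicGeometry.ModuliOfAbelianVarieties

namespace W1

open CategoryTheory CategoryTheory.Limits Matrix Topology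
open scoped Matrix.Norms.Elementwise
open Literature.AlgebraicGeometry.Motives (SchemeOver ComplexPoints AlgPoints specOver AbelianVariety CartierDivisor
  baseChangeHom baseChangeHomFst fiberOver fiberι fiberOverToSpec fiberOverBaseChangeIsoOfIsPullback)
open Literature.AlgebraicGeometry.AbelianSchemes (PolarizedAbelianSchemeWithLevel AbelianSchemeOver)
open Literature.Geometry.Kaehler (ComplexTorus)
open Literature.NumberTheory.Transcendental (IsAnalytification)
open Literature.NumberTheory.Automorphic (siegelUpperHalfSpace)
open Literature.NumberTheory.Adeles (latticeOfGL)
open SiegelModuli (jOfSiegel)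

variable {g N : ℕ} {δ : Fin g → ℕ} (𝓜 : SiegelFineModuliScheme g N δ)

/-- The TOTAL SPACE of the universal abelian scheme as a `ℚ`-scheme (structure map `X → M → Spec ℚ`).
[cite: MumfordFogartyKirwan1994, Ch. 7 §3 Theorem 7.9 (p. 139)] -/
noncomputable def univTotal : SchemeOver ℚ := Over.mk (𝓜.univ.A.X.hom ≫ 𝓜.M.hom)

/-- The universal family `X → M` as a morphism of `ℚ`-schemes. [cite: MumfordFogartyKirwan1994, Ch. 7 §3 Theorem 7.9 (p. 139)] -/
noncomputable def univFamily : univTotal 𝓜 ⟶ 𝓜.M := Over.homMk 𝓜.univ.A.X.hom rfl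

/-- The COMPLEXIFIED universal family `X ⊗_ℚ ℂ → M ⊗_ℚ ℂ` (under the (α) fork `Sg.Mc := Nm ⋙ baseChange ℚ ℂ` this is the family
whose restrictions to the pieces are W1's `datum.f`). [cite: MumfordFogartyKirwan1994, Appendix to Ch. 7 §A (p. 235)] -/
noncomputable def univFamilyℂ : (Motives.baseChange ℚ ℂ).obj (univTotal 𝓜) ⟶ (Motives.baseChange ℚ ℂ).obj 𝓜.M :=
  (Motives.baseChange ℚ ℂ).map (univFamily 𝓜)

/-- **The fibre of the complexified universal family over a complex point `t` IS the abelian scheme of any triple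
classified along the `ℚ`-side reading of `t`**: if `P′` over `Spec ℂ` is a pull-back of the universal triple along
`s := (baseChangeEquiv (algebraMap ℚ ℂ) 𝓜.M).symm t` via `G` (D4 (R) `IsBaseChangeVia`), then
`fiberOver univFamilyℂ t ≅ P′.A.X` as `ℂ`-schemes (only the cartesian `X`-square of the relation is used).
[cite: MumfordFogartyKirwan1994, Ch. 7 §2 Definition 7.3 (p. 130) and §3 Theorem 7.9 (p. 139)] [cite: GortzWedhorn2020, Prop. 4.16] -/
noncomputable def fiberUnivIsoOfIsBaseChangeVia (t : ComplexPoints ((Motives.baseChange ℚ ℂ).obj 𝓜.M))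
    (P' : PolarizedAbelianSchemeWithLevel g N δ (specOver ℚ ℂ).left)
    (G : P'.A.X.left ⟶ 𝓜.univ.A.X.left) (Ĝ : P'.D.hat.X.left ⟶ 𝓜.univ.D.hat.X.left)
    (h : P'.IsBaseChangeVia 𝓜.univ ((AlgPoints.baseChangeEquiv (algebraMap ℚ ℂ) 𝓜.M).symm t).left G Ĝ) :
    fiberOver (univFamilyℂ 𝓜) t ≅ P'.A.X :=
  fiberOverBaseChangeIsoOfIsPullback (algebraMap ℚ ℂ) (univFamily 𝓜) t P'.A.X G
    ((AlgPoints.baseChangeEquiv (algebraMap ℚ ℂ) 𝓜.M).symm t).left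
    (AlgPoints.baseChangeEquiv_symm_apply_left (σ := algebraMap ℚ ℂ) (X := 𝓜.M) t).symm
    (by
      obtain ⟨⟨⟨_, hpb, _, _⟩, _⟩, _, _, _⟩ := h
      exact hpb)

end W1

end Literature.AlgebraicGeometry.ModuliOfAbelianVarieties
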